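import Literature.InformationTheory.QuantumCodes.PauliNoise
import Literature.InformationTheory.QuantumCodes.LogicalFailure
import Literature.InformationTheory.QuantumCodes.ToricCodeThreshold
import HarnessLib

/-!
# Independent bit flips as a product law on `𝔽₂`-vectors, and the bridge between the two
# renderings of the failure probability (finite sum of `bernoulliWeight` vs. `PMF` mass)

Topic `Literature/InformationTheory/QuantumCodes` (venture QEC, LADDER-QEC Q5, PARTITION row 09).
Column words: DEFINITION (`bitLaw`), PROVED (everything else). Consistency glue, no new claim:

* `bitLaw p` (`p ≤ 1`): the Bernoulli law on `ZMod 2` — the bit is flipped (`1`) with probability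
  `p` ("errors arise independently on each link with probability `p`", Dennis et al. §4.4); the
  register law is `iidLaw (bitLaw p hp) : PMF (ι → ZMod 2)` (`PauliNoise.lean`).
* `toReal_iidLaw_bitLaw`: its mass at the error vector `e` is DKLP's
  `prob(E) = ∏_ℓ (1-p)^{1-n_E(ℓ)} p^{n_E(ℓ)} = p^{|E|}(1-p)^{N-|E|}` with `E = supp e`, i.e. the tree's
  `bernoulliWeight p (supp e)` (§4.4 eq. (prob_E)).
* `ToricCode.failureProb_eq_toReal_logicalFailureProb`: the toric-code failure probability of
  `ToricCodeThreshold.lean` (a finite real sum) IS the `PMF`-valued `Decoder.logicalFailureProb` of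
  `LogicalFailure.lean` for the law `iidLaw (bitLaw p hp)`, read in `ℝ` — so the D4″ statements and
  the generic `HasThreshold` vocabulary speak about the same number.

## References (read)

* [DennisEtAl2002] E. Dennis, A. Kitaev, A. Landahl, J. Preskill, *Topological quantum memory*,
  J. Math. Phys. 43 (2002) 4452–4505, arXiv:quant-ph/0110143, §4.4 eq. (prob_E), §4.3 eq. (ec_cond).
-/

noncomputable section

namespace Literature.InformationTheory.QuantumCodes

open Finset
open scoped ENNReal NNReal

/-! ### The Bernoulli law on one bit and its product -/

/-- The **bit-flip law** on `𝔽₂`: the bit is `1` (an error on this link) with probability `p` and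
`0` with probability `1 - p`. [cite: DennisEtAl2002, §4.4 (errors arise independently on each link with probability p)] -/
def bitLaw (p : ℝ≥0) (hp : p ≤ 1) : PMF (ZMod 2) :=
  PMF.ofFintype (fun b => if b = 0 then ((1 - p : ℝ≥0) : ℝ≥0∞) else (p : ℝ≥0∞)) (by
    have huniv : (Finset.univ : Finset (ZMod 2)) = {0, 1} := by decide
    rw [huniv, Finset.sum_pair (by decide)]
    simp only [if_true, one_ne_zero, if_false]
    rw [← ENNReal.coe_add, tsub_add_cancel_of_le hp, ENNReal.coe_one])

/-- The bit-flip law at a bit: `1 - p` at `0`, `p` at `1`. [cite: DennisEtAl2002, §4.4 eq. (prob_E)] -/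
theorem bitLaw_apply (p : ℝ≥0) (hp : p ≤ 1) (b : ZMod 2) :
    bitLaw p hp b = if b = 0 then ((1 - p : ℝ≥0) : ℝ≥0∞) else (p : ℝ≥0∞) := rfl

/-- **`prob(E) = p^{|E|} (1-p)^{N-|E|}`**: the product bit-flip law gives the error vector `e` the
Bernoulli weight of its support. [cite: DennisEtAl2002, §4.4 eq. (prob_E)] -/
theorem toReal_iidLaw_bitLaw {ι : Type*} [Fintype ι] [DecidableEq ι] (p : ℝ≥0) (hp : p ≤ 1)
    (e : ι → ZMod 2) :
    (iidLaw (bitLaw p hp) e).toReal = bernoulliWeight (p : ℝ) (supp e) := by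
  rw [iidLaw_apply]
  -- write the product over `ℝ≥0`, then over `ℝ`
  have hprod : (∏ i, bitLaw p hp (e i)) =
      ((∏ i, (if e i = 0 then (1 - p) else p : ℝ≥0) : ℝ≥0) : ℝ≥0∞) := by
    rw [ENNReal.ofNNReal_finsetProd]
    refine Finset.prod_congr rfl fun i _ => ?_
    rw [bitLaw_apply]
    split_ifs <;> rfl
  rw [hprod, ENNReal.coe_toReal, NNReal.coe_prod]
  -- split the product along the support
  have hsplit : (∏ i, ((if e i = 0 then (1 - p) else p : ℝ≥0) : ℝ)) =
      (∏ i ∈ univ.filter (fun i => e i = 0), ((1 - p : ℝ≥0) : ℝ)) *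
        ∏ i ∈ univ.filter (fun i => ¬ e i = 0), (p : ℝ) := by
    rw [← Finset.prod_filter_mul_prod_filter_not univ (fun i => e i = 0)]
    congr 1
    · refine Finset.prod_congr rfl fun i hi => ?_
      rw [if_pos (mem_filter.1 hi).2]
    · refine Finset.prod_congr rfl fun i hi => ?_
      rw [if_neg (mem_filter.1 hi).2]
  rw [hsplit, prod_const, prod_const, NNReal.coe_sub hp, NNReal.coe_one]
  have hsupp : univ.filter (fun i => ¬ e i = 0) = supp e := by
    ext i; simp [supp]
  have hcard : (univ.filter (fun i => e i = 0)).card = Fintype.card ι - (supp e).card := by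
    rw [← hsupp]
    have := Finset.card_filter_add_card_filter_not (s := (univ : Finset ι)) (fun i => e i = 0)
    rw [Finset.card_univ] at this
    omega
  rw [hcard, hsupp, bernoulliWeight, mul_comm]

/-! ### The toric-code failure probability is a `PMF` mass -/

namespace ToricCode

/-- **One number, two vocabularies**: the failure probability of `ToricCodeThreshold.lean`
(`Σ_{e : recovery fails} p^{|e|}(1-p)^{2L²-|e|}`) equals the `PMF`-valued logical failure probability
of `LogicalFailure.lean` for independent bit flips of rate `p`, read in `ℝ`.
[cite: DennisEtAl2002, §4.3 eq. (ec_cond)] -/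
theorem failureProb_eq_toReal_logicalFailureProb (L : ℕ) [NeZero L] (D : ZDecoder L) (p : ℝ≥0)
    (hp : p ≤ 1) :
    failureProb L D (p : ℝ) =
      ((D.logicalFailureProb (syn L) (boundaries L) (iidLaw (bitLaw p hp))).toReal) := by
  classical
  rw [Decoder.logicalFailureProb_eq_sum, ENNReal.toReal_sum (fun e _ => PMF.apply_ne_top _ e),
    failureProb]
  refine Finset.sum_congr ?_ fun e _ => (toReal_iidLaw_bitLaw p hp e).symm
  exact filter_congr fun e _ => Iff.rfl

end ToricCode

end Literature.InformationTheory.QuantumCodes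

end
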